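import Mathlib
import Literature.NumberTheory.LFunctions.Zhang2022.TypedSection15CRel
import Literature.NumberTheory.LFunctions.Zhang2022.Section15CStep15u054
import Literature.NumberTheory.LFunctions.Zhang2022.Section15CU055Contour
import Literature.NumberTheory.LFunctions.Zhang2022.Section15CU055ResidueTerm
import Literature.NumberTheory.LFunctions.Zhang2022.Section15CU055FrontEnd
import HarnessLib

/-!
# Zhang (2022) §15 p. 87, u055 in the reading of record: `Step15_u055RelS` holds — the leaf h15u055R

Topic `Literature/NumberTheory/LFunctions/Zhang2022` (Landau–Siegel audit tree; verdict-neutral).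
Y. Zhang, *Discrete mean estimates and the Landau–Siegel zero*, arXiv:2211.02515v1 (2022)
[Zhang2022LandauSiegel] — **an unrefereed manuscript under adjudication; nothing here asserts or denies
its Theorems 1–2.** ZHANG-L WP15, leaf h15u055R in the reading of record RT-07′
(`Typed.Section15C.Step15_u055RelS`, file `TypedSection15CRel`): «By Lemma 15.3, we can move the contour
of integration in the same way as in the proof of Lemma 8.4 to obtain
`Σ_{n<T} χ(n)τ₂(n)ϖ₁ⱼ(n)/n = L′(1,χ)²𝒰₁ⱼ(1) + O(α₁)`» (§15 p. 87, tex L4359–L4361), with the error of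
record `C·α𝓛³·((1+|L′(1,χ)|)²·S + 1)` for every continuation `U` of the repaired `𝒰₁ⱼ` (`IsCalU1R`) that
is bounded by `S` on `|s−1| ≤ 1/𝓛` and by `S·e^{2𝓛^{1/10}}` on `Re s ≥ 9/10`.

Assembly of TREE THEOREMS only: u054 `Typed.Section15C.step15_u054_holds` (unsmoothing + exact Mellin
step, zl-libC-p4), the identification of the Mellin integrand with `ζ(1+s)²L(1+s−βⱼ,χ)²U(1+s)·Tˢω₁(s)/s` on
`Re s = 1` (`U055.mellinIntegral_inputs15AB_eq_lineIntegral`, zl-libA-p5, `Section15CU055FrontEnd`), the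
contour shift `U055.norm_integral_sub_residue_le_growth` (Landau's rectangle, `Section15CU055Contour`)
and the residue evaluation `U055.norm_residue_sub_main_le` (`Section15CU055ResidueTerm`).

* `step15_u055RelS_holds : ∀ c′, Step15_u055RelS c′ inputs15AB` — the v30+ binder h15u055R BY NAME.

WHAT THIS IS NOT: anything about Theorems 1–2 / Landau–Siegel zeros; the printed absolute `O(α₁)` is NOT
claimed (RT-07′).

## References
* Y. Zhang, arXiv:2211.02515v1 (2022), §15 p. 87, tex L4354–L4361. [cite: Zhang2022LandauSiegel, §15 p.87]
-/

noncomputable section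

open Complex Real Set Filter Topology Metric MeasureTheory

namespace Literature.NumberTheory.LFunctions.Zhang2022.Typed.Section15C

open Literature.NumberTheory.LFunctions.Zhang2022.Skeleton GaussWeight

/-! ### The leaf -/

/-- `M ≤ 𝓛` once `D ≥ ⌈e^M⌉`. [cite: Zhang2022LandauSiegel, §2 (2.1)] -/
private theorem le_ell_of_ceil_exp_le₉ {M : ℝ} {D : ℕ} (hD : ⌈Real.exp M⌉₊ ≤ D) : M ≤ ell D := by
  have h : Real.exp M ≤ D := le_trans (Nat.le_ceil _) (by exact_mod_cast hD)
  exact (Real.le_log_iff_exp_le (lt_of_lt_of_le (Real.exp_pos _) h)).mpr h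

/-- **Z22:§15.u055 in the reading of record (`Step15_u055RelS`, RT-07′) HOLDS** for the manuscript's own
objects (`inputs15AB`) and every `c′`: for all large `D`, under (A), for `j ∈ {1,2,3}`, every analytic
continuation `U` of the repaired `𝒰₁ⱼ` with `‖U‖ ≤ S` on `|s−1| ≤ 1/𝓛` and `‖U‖ ≤ S·e^{2𝓛^{1/10}}` on
`Re s ≥ 9/10` satisfies `‖Σ_{n<T} χ(n)τ₂(n)ϖ₁ⱼ(n)/n − L′(1,χ)²U(1)‖ ≤ C·α𝓛³·((1+|L′(1,χ)|)²S + 1)`.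
Proof: u054 (`step15_u054_holds`) + `U055.mellinIntegral_inputs15AB_eq_lineIntegral` + the contour shift
`U055.norm_integral_sub_residue_le_growth` + the residue `U055.norm_residue_sub_main_le`.
[cite: Zhang2022LandauSiegel, §15 p.87] -/
theorem step15_u055RelS_holds (c' : ℝ) : Step15_u055RelS c' inputs15AB := by
  obtain ⟨C₅₄, h54⟩ := step15_u054_holds c'
  obtain ⟨C_R, hCR0, hR⟩ := U055.norm_residue_sub_main_le c'
  set Z2 : ℝ := ∑' n : ℕ, ‖LSeries.term (1 : ℕ → ℂ) 2 n‖ with hZ2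
  set M : ℝ := max (max 31000 (12 * Z2 ^ 4)) (14 * |c'| * π + 1) with hM
  have hT : ForAllLarge fun D _ _ => M ≤ ell D :=
    ForAllLarge.of_le ⌈Real.exp M⌉₊ fun D _ _ hD _ _ => le_ell_of_ceil_exp_le₉ hD
  obtain ⟨D₀, h⟩ := ((h54.and hR).and hT)
  refine ⟨max |C₅₄| (1 + C_R), max D₀ 8, fun D _ χ hD hq hp hA j hj U hU S hS1 hS2 => ?_⟩
  have hD₀ : D₀ ≤ D := le_trans (le_max_left _ _) hD
  have hD8 : 8 ≤ D := le_trans (le_max_right _ _) hD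
  obtain ⟨⟨g54, gR⟩, hMℓ⟩ := h D χ hD₀ hq hp
  have hℓ31 : (31000 : ℝ) ≤ ell D := le_trans (le_trans (le_max_left _ _) (le_max_left _ _)) hMℓ
  have hℓZ : 12 * Z2 ^ 4 ≤ ell D := le_trans (le_trans (le_max_right _ _) (le_max_left _ _)) hMℓ
  have hℓc : 14 * |c'| * π + 1 ≤ ell D := le_trans (le_max_right _ _) hMℓ
  have hℓ1 : 1 ≤ ell D := by linarith
  have hℓ0 : 0 < ell D := by linarith
  -- `βⱼ`: purely imaginary, `|Im βⱼ| ≤ 1`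
  have hα : alpha D = π / ell D ^ 9 := by rw [alpha, bigP, Real.log_exp]
  have hαpos : 0 < alpha D := by rw [hα]; positivity
  have hθ : |c' * alpha D * ell D| ≤ 1 / 14 := by
    have hα1 : alpha D * ell D = π / ell D ^ 8 := by rw [hα]; field_simp
    rw [abs_mul, abs_mul, abs_of_pos hαpos, abs_of_pos hℓ0, mul_assoc, hα1,
      show |c'| * (π / ell D ^ 8) = |c'| * π / ell D ^ 8 by ring,
      div_le_div_iff₀ (by positivity) (by norm_num)]
    have h8 : ell D ≤ ell D ^ 8 := by
      calc ell D = ell D ^ 1 := (pow_one _).symm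
        _ ≤ ell D ^ 8 := pow_le_pow_right₀ hℓ1 (by norm_num)
    nlinarith [abs_nonneg c', Real.pi_pos]
  obtain ⟨hβ5, hβre⟩ := Ded1524.betaJ_norm_lt c' hαpos hθ hj
  have hα1 : 5 * alpha D ≤ 1 := by
    rw [hα]
    have h9 : (5 * π : ℝ) ≤ ell D ^ 9 := by
      calc (5 * π : ℝ) ≤ 5 * 4 := by nlinarith [Real.pi_lt_d2]
        _ ≤ ell D := by linarith
        _ = ell D ^ 1 := (pow_one _).symm
        _ ≤ ell D ^ 9 := pow_le_pow_right₀ hℓ1 (by norm_num)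
    rw [show 5 * (π / ell D ^ 9) = 5 * π / ell D ^ 9 by ring, div_le_one (by positivity)]
    exact h9
  have hβi : |(betaJ c' D j).im| ≤ 1 :=
    ((Complex.abs_im_le_norm _).trans hβ5.le).trans hα1
  -- `S ≥ 0`
  have hS0 : 0 ≤ S := (norm_nonneg _).trans (hS1 1 (by simp; positivity))
  -- the four pieces
  have e54 : ‖sumLtT c' inputs15AB χ j - mellinIntegral c' inputs15AB χ j‖ ≤ C₅₄ * (alpha D * ell D) :=
    (g54 hA j hj).2
  have eId := U055.mellinIntegral_inputs15AB_eq_lineIntegral c' χ j hU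
  have eC := U055.norm_integral_sub_residue_le_growth χ hD8 hp hℓ31 hℓZ hβre hβi hU.1 hS0 hS2
  have eR := gR hA j hj U hU.1 S hS1
  -- combine
  set Res := (Function.swap dslope (0 : ℂ))^[2]
    (fun z => riemannZeta₁ (1 + z) ^ 2 * (χ.LFunction (1 + z - betaJ c' D j) ^ 2 * U (1 + z)) *
      (((bigT D : ℝ) : ℂ) ^ z * omega1 (ell D ^ 30) z)) 0 with hRes
  set I₀ := (1 / (2 * π) : ℂ) * ∫ t : ℝ,
        (riemannZeta (1 + (((1 : ℝ) : ℂ) + t * I)) ^ 2 *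
            (χ.LFunction (1 + (((1 : ℝ) : ℂ) + t * I) - betaJ c' D j) ^ 2 *
              U (1 + (((1 : ℝ) : ℂ) + t * I)))) *
          (((bigT D : ℝ) : ℂ) ^ (((1 : ℝ) : ℂ) + t * I) * omega1 (ell D ^ 30) (((1 : ℝ) : ℂ) + t * I) /
            (((1 : ℝ) : ℂ) + t * I)) with hI₀
  set ℓ := ‖deriv χ.LFunction 1‖ with hℓdef
  have key : ‖sumLtT c' inputs15AB χ j - deriv χ.LFunction 1 ^ 2 * U 1‖ ≤
      C₅₄ * (alpha D * ell D) + S * (alpha D * ell D ^ 3) +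
        C_R * (alpha D * ell D ^ 3) * ((1 + ℓ) ^ 2 * S) := by
    have e : sumLtT c' inputs15AB χ j - deriv χ.LFunction 1 ^ 2 * U 1 =
        (sumLtT c' inputs15AB χ j - mellinIntegral c' inputs15AB χ j) + (I₀ - Res) +
          (Res - deriv χ.LFunction 1 ^ 2 * U 1) := by rw [eId, hI₀]; ring
    rw [e]
    calc _ ≤ ‖sumLtT c' inputs15AB χ j - mellinIntegral c' inputs15AB χ j‖ + ‖I₀ - Res‖ +
          ‖Res - deriv χ.LFunction 1 ^ 2 * U 1‖ := norm_add₃_le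
      _ ≤ _ := by gcongr
  refine key.trans ?_
  -- bookkeeping: everything is `≤ max(|C₅₄|, 1 + C_R)·α𝓛³·((1+ℓ)²S + 1)`
  have hαℓ : alpha D * ell D ≤ alpha D * ell D ^ 3 := by
    apply mul_le_mul_of_nonneg_left _ hαpos.le
    calc ell D = ell D ^ 1 := (pow_one _).symm
      _ ≤ ell D ^ 3 := pow_le_pow_right₀ hℓ1 (by norm_num)
  have hA3 : 0 ≤ alpha D * ell D ^ 3 := by positivity
  have h1ℓ : S ≤ (1 + ℓ) ^ 2 * S := by
    have : (1 : ℝ) ≤ (1 + ℓ) ^ 2 := by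
      have h0 : 0 ≤ ℓ := norm_nonneg _
      nlinarith
    exact le_mul_of_one_le_left hS0 this
  have hP : 0 ≤ (1 + ℓ) ^ 2 * S := by positivity
  set K : ℝ := max |C₅₄| (1 + C_R) with hK
  have hK1 : |C₅₄| ≤ K := le_max_left _ _
  have hK2 : 1 + C_R ≤ K := le_max_right _ _
  have hK0 : 0 ≤ K := le_trans (abs_nonneg _) hK1
  have t₁ : C₅₄ * (alpha D * ell D) ≤ |C₅₄| * (alpha D * ell D ^ 3) :=
    (mul_le_mul_of_nonneg_right (le_abs_self _) (by positivity)).trans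
      (mul_le_mul_of_nonneg_left hαℓ (abs_nonneg _))
  have t₂ : S * (alpha D * ell D ^ 3) ≤ (alpha D * ell D ^ 3) * ((1 + ℓ) ^ 2 * S) := by
    rw [mul_comm]; exact mul_le_mul_of_nonneg_left h1ℓ hA3
  have t₃ : (1 + C_R) * ((1 + ℓ) ^ 2 * S) ≤ K * ((1 + ℓ) ^ 2 * S) := mul_le_mul_of_nonneg_right hK2 hP
  have t₄ : |C₅₄| ≤ K * 1 := by rw [mul_one]; exact hK1
  calc C₅₄ * (alpha D * ell D) + S * (alpha D * ell D ^ 3) +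
        C_R * (alpha D * ell D ^ 3) * ((1 + ℓ) ^ 2 * S)
      ≤ |C₅₄| * (alpha D * ell D ^ 3) + (alpha D * ell D ^ 3) * ((1 + ℓ) ^ 2 * S) +
          C_R * (alpha D * ell D ^ 3) * ((1 + ℓ) ^ 2 * S) := by linarith
    _ = (alpha D * ell D ^ 3) * ((1 + C_R) * ((1 + ℓ) ^ 2 * S) + |C₅₄|) := by ring
    _ ≤ (alpha D * ell D ^ 3) * (K * ((1 + ℓ) ^ 2 * S) + K * 1) :=
        mul_le_mul_of_nonneg_left (add_le_add t₃ t₄) hA3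
    _ = K * (alpha D * ell D ^ 3) * ((1 + ℓ) ^ 2 * S + 1) := by ring

end Literature.NumberTheory.LFunctions.Zhang2022.Typed.Section15C
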